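import Summits.CriticalPhenomena.PercolationContinuityZ3.Theorems.PercNearOneGluingNoHeavyQuantTreeBuiltAD3Cells
import HarnessLib

/-!
# QUANT lane R8, T-DEC, ROUTE 2 AFTER THE REFUTATION OF `AD3ProdCell`: the content of `TreeBuiltAD3` is ONE law-level node — the
# convolution closure of AD3⁺ ON TREE-BUILT FACTORS (`AD3ConvClosedTB`); `AD3GateCell ∧ AD3ConvClosedTB ⟹ TreeBuiltAD3 ⟹ FarTreeRow`
# and conversely `TreeBuiltAD3 ⟹ AD3ConvClosedTB` (kernel)

builds on p205010 (kernel theorem, internal audit signed; external expert review pending)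

Support file (`--supports stmt-CriticalPhenomena-4575`), QUANT lane, TYPER seat prim-quant-stmt (gen 32), rung R8 of
`run/shared/lean/prim/quant/LADDER.md`; continues `…QuantTreeBuiltCells` (`AD3Decomp`, `TreeBuiltAD3`), `…QuantTreeBuiltAD3Rows`
(`TreeBuiltAD3 ⟹ FarTreeRow`) and `…QuantTreeBuiltAD3Cells` (`AD3GateCell`, the refuted `AD3ProdCell`, the structural induction).  One
`@[conjecture]` definition, theorems with standard axioms, no sorries.

WHY THIS FILE.  Typer g31's Route 2 proved `TreeBuiltAD3` (every tree-built count law is a mixture of admissible ≤ 3-atom laws of its own mean,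
at every gate) from two FINITE-PARAMETER decomposition cells, the gate of a component (`AD3GateCell` — TRUE: arm-2 g37, kernel in scratch,
`ad3GateCell_of_triple4` + the 4-atom structure theorem) and the product of two components (`AD3ProdCell` — FALSE: arm-2 g37's exact witness
`TR[1,2,4; 1/10,1/5,7/10] ∗ TP[0,8; 4/5]` at `(y, q) = (99/125, 99/100)`, kernel `LawDec.not_ad3ProdCell`, countersigned by ARM-REF g98/g99 and
the lead g35, README V349).  The product cell quantified over ALL pairs of admissible components; the class "mixtures of admissible ≤ 3-atom
laws" is simply not closed under convolution.  Typer g32's exact engine (`run/shared/lean/prim/quant/prim-quant-stmt-g32/explore/adtcell.py`,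
column generation over per-support flow LPs, cross-checked on arm-2's `dec.py`) adds: (a) NO admissibility-defined component class repairs the
product cell — with components admissible at the law's TARGET rather than of mean `T` ("level" components) the bad product decomposes
(`1/10·{1,12;4/5} + 1/5·{2,12;4/5} + 1/5·{4,10;4/5} + 11/70·{4,12;4/5} + 12/35·{4:1/5, 9:7/30, 12:17/30}`), but then products of two
level-admissible components need not even be admissible (1 117 / 8 593 random pairs; e.g. `{0,2;2/5}` at level `4/5` ⊗ `{0,3;2/5}` at level `3`,
`q = 19/20`, `x = 2/5`); (b) pairs never suffice — the two-blob forest `(7 relays under gate 7/20) ⊔ (1 relay under gate 7/20)`, `M = 8`,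
`x ↑ 7/20`, is DEC at every layer but admits no single pair decomposition serving all layers (exact margin `−0.066`), while it IS AD3⁺ through the
triple `{0,1,7}`; (c) the WHOLE tree-built product survives where the component product fails: `star(4 leaves, gate 33/40) ⊔ blob(8, γ)`,
`γ ∈ {4/5, 0.8001, 81/100, 33/40}`, floors up to the least marginal `− 10⁻⁵`, 66 / 66 AD3⁺ at `q = 1`, although the star's own admissible vertex
component `{1: 159/860, 2: 25/344, 4: 1277/1720}` times the blob is NOT AD3⁺ (the star decomposes into blob-compatible components instead:
`{2,4;13/20}`, `{3,4;3/10}`, `{0,1,4; 1/10,1/10,4/5}`, `{1,3,4; 1/5,1/10,7/10}`).  CONCLUSION RECORDED HERE: the product step of Route 2 is a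
statement about PAIRS OF TREE-BUILT LAWS, not about pairs of components — `AD3ConvClosedTB` below — and modulo the (true) gate cell it is ALL of
`TreeBuiltAD3` (`treeBuiltAD3_iff_convClosedTB`).  This is the Route-2 analogue of Route 1's node `SDECConvClosedTB` (`…QuantTreeBuiltCells`):
Route 1 asks the convolution of tree-built SDEC laws to be SDEC (admissible), Route 2 asks the convolution of tree-built AD3⁺ laws to be AD3⁺
(decomposable); `AD3ConvClosedTB ⟹ SDECConvClosedTB` (`sdecConvClosedTB_of_ad3ConvClosedTB`, through `TreeBuiltAD3`).

* `LawDec.AD3ConvClosedTB` (`@[conjecture]`): for tree-built `μ₁`, `μ₂` at a common floor `x`, each AD3⁺-decomposable at `(q·x, q)` for every gate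
  `q`, the convolution is AD3⁺-decomposable at `(q·x, q, T₁ + T₂, M₁ + M₂)` for every gate `q`.  EVIDENCE = that of `TreeBuiltAD3` (every tree-built
  law with two top-level items is such a convolution): typer g31 187 k / 0, lead g35 3 000 near-limit-floor laws / 0, typer g32 (c) above + 834 / 0
  two- and three-blob forests at limit floors.
* **`LawDec.ad3Decomp_of_treeBuilt_conv`** — the structural induction with the conv step supplied by `AD3ConvClosedTB` (gate step by `AD3GateCell`,
  floors `x′ ≤ x` carried along, `TreeBuilt.mono` used to place both factors at the lower floor);
  **`LawDec.treeBuiltAD3_of_gateCell_convClosedTB : AD3GateCell → AD3ConvClosedTB → TreeBuiltAD3`**.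
* **`LawDec.ad3ConvClosedTB_of_treeBuiltAD3 : TreeBuiltAD3 → AD3ConvClosedTB`** (a convolution of tree-built laws is tree-built);
  `LawDec.treeBuiltAD3_iff_convClosedTB : AD3GateCell → (TreeBuiltAD3 ↔ AD3ConvClosedTB)`.
* `LawDec.sdecConvClosedTB_of_ad3ConvClosedTB`, **`farTreeRow_of_gateCell_convClosedTB : AD3GateCell → AD3ConvClosedTB → Quant.FarTreeRow`**.
HONEST STATUS: `AD3ConvClosedTB`, `TreeBuiltAD3`, `SDECConvClosedTB`, `TreeBuiltDEC`, `FarTreeRow` OPEN; `AD3GateCell` true in scratch (arm-2 g37),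
`AD3ProdCell` REFUTED; no finite-parameter cell for the product step is known or expected (memo
`run/shared/lean/prim/quant/prim-quant-stmt-g32/ROUTE2-REPAIR-G32.md`); nothing here is a published result; RATE class log\* / honest sentence
unchanged.

[this work]; `TreeBuilt`: prim-quant-census-2 g53; `AD3Decomp`/induction: prim-quant-stmt g31; refutation of the product cell: prim-quant-arm-2 g37
(this lane).  The gluing rows served [cite: KozmaNitzan2024, Conjecture 3 (p. 15)]; product measure [cite: Grimmett1999, §1.3 p. 10].
-/

noncomputable section

namespace Summit.CriticalPhenomena.PercolationContinuityZ3.Theorems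

namespace Quant

open Finset

namespace LawDec

/-! ### The node -/

/-- **CONJECTURE `AD3ConvClosedTB` (Route 2's product step at law level; typer g32).**  For tree-built laws `μ₁`, `μ₂` (`LawDec.TreeBuilt x Mᵢ μᵢ`,
common floor `x`) which are AD3⁺-decomposable at `(q·x, q)` at their own means for every gate `0 < q ≤ 1`, the convolution `lconv M₁ M₂ μ₁ μ₂`
is AD3⁺-decomposable at `(q·x, q)`, mean `T₁ + T₂`, top `M₁ + M₂`, for every gate `0 < q ≤ 1`.  Equivalent to `TreeBuiltAD3` given the gate cell
(`treeBuiltAD3_iff_convClosedTB`); NOT reducible to pairs of components (`LawDec.not_ad3ProdCell`, arm-2 g37; module docstring (a)–(c)).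
EVIDENCE: that of `TreeBuiltAD3` (exact census ≈ 190 000 tree-built laws / 0, incl. the star ⊔ blob forests built on the refuting mechanism).
builds on p205010 (kernel theorem, internal audit signed; external expert review pending). [this work] [status: open] -/
@[conjecture] def AD3ConvClosedTB : Prop :=
  ∀ (x : ℝ) (M₁ M₂ : ℕ) (μ₁ μ₂ : ℕ → ℝ), TreeBuilt x M₁ μ₁ → TreeBuilt x M₂ μ₂ →
    (∀ q : ℝ, 0 < q → q ≤ 1 → AD3Decomp (q * x) q (∑ k ∈ Finset.range (M₁ + 1), (k : ℝ) * μ₁ k) M₁ μ₁) →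
    (∀ q : ℝ, 0 < q → q ≤ 1 → AD3Decomp (q * x) q (∑ k ∈ Finset.range (M₂ + 1), (k : ℝ) * μ₂ k) M₂ μ₂) →
    ∀ q : ℝ, 0 < q → q ≤ 1 →
      AD3Decomp (q * x) q
        (∑ k ∈ Finset.range (M₁ + 1), (k : ℝ) * μ₁ k + ∑ k ∈ Finset.range (M₂ + 1), (k : ℝ) * μ₂ k) (M₁ + M₂) (lconv M₁ M₂ μ₁ μ₂)

/-! ### The structural induction with the law-level product step -/

/-- **THE INDUCTION: `AD3GateCell ∧ AD3ConvClosedTB ⟹` every tree-built law is AD3⁺-decomposable at every gate and every floor `x′ ≤ x`.**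
Typer g31's `ad3Decomp_of_treeBuilt` with the conv step replaced: both factors are tree-built at the lower floor `x′` (`TreeBuilt.mono`) and
AD3⁺-decomposable there at every gate (induction hypotheses), so `AD3ConvClosedTB` applies at `x′`. [this work] -/
theorem ad3Decomp_of_treeBuilt_conv (hG : AD3GateCell) (hC : AD3ConvClosedTB) {x : ℝ} {M : ℕ} {μ : ℕ → ℝ} (h : TreeBuilt x M μ) :
    ∀ x' : ℝ, 0 < x' → x' ≤ x → ∀ q : ℝ, 0 < q → q ≤ 1 →
      AD3Decomp (q * x') q (∑ k ∈ Finset.range (M + 1), (k : ℝ) * μ k) M μ := by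
  induction h with
  | nil x₀ hx0 hx1 =>
    intro x' hx'0 hx'x q hq0 hq1
    have e : ∑ k ∈ Finset.range (0 + 1), (k : ℝ) * (if k = 0 then (1 : ℝ) else 0) = ((0 : ℕ) : ℝ) := by simp
    rw [e]
    exact ad3Decomp_of_component (isAD3Component_point (q * x') q 0 0 le_rfl (by nlinarith))
  | relay x₀ hx0 hx1 =>
    intro x' hx'0 hx'x q hq0 hq1
    have e : ∑ k ∈ Finset.range (1 + 1), (k : ℝ) * (if k = 1 then (1 : ℝ) else 0) = ((1 : ℕ) : ℝ) := by
      simp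
    rw [e]
    exact ad3Decomp_of_component (isAD3Component_point (q * x') q 1 1 le_rfl (by nlinarith))
  | @conv x₀ M₁ M₂ μ₁ μ₂ h₁ h₂ ih₁ ih₂ =>
    intro x' hx'0 hx'x q hq0 hq1
    obtain ⟨-, -, -, -, s1, -⟩ := treeBuilt_lawFacts h₁
    obtain ⟨-, -, -, -, s2, -⟩ := treeBuilt_lawFacts h₂
    rw [sum_mul_lconv M₁ M₂ μ₁ μ₂ s1 s2]
    exact hC x' M₁ M₂ μ₁ μ₂ (TreeBuilt.mono h₁ hx'0 hx'x) (TreeBuilt.mono h₂ hx'0 hx'x)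
      (fun q' hq'0 hq'1 => ih₁ x' hx'0 hx'x q' hq'0 hq'1) (fun q' hq'0 hq'1 => ih₂ x' hx'0 hx'x q' hq'0 hq'1) q hq0 hq1
  | @gate x₀ M₀ μ₀ q₀ hq₀0 hq₀1 h ih =>
    intro x' hx'0 hx'x q hq0 hq1
    obtain ⟨hx0, hx1, n1, z1, s1, t1⟩ := treeBuilt_lawFacts h
    set T : ℝ := ∑ k ∈ Finset.range (M₀ + 1), (k : ℝ) * μ₀ k with hT
    rw [sum_mul_gate]
    have hx''0 : 0 < x' / q₀ := div_pos hx'0 hq₀0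
    have hx''x : x' / q₀ ≤ x₀ := by rw [div_le_iff₀ hq₀0]; linarith [mul_comm q₀ x₀]
    have hD := ih (x' / q₀) hx''0 hx''x (q * q₀) (mul_pos hq0 hq₀0) (by nlinarith)
    have ey : q * q₀ * (x' / q₀) = q * x' := by field_simp
    rw [ey] at hD
    obtain ⟨κ, _, v, ω, hv0, hv1, hμ, hc⟩ := (ad3Decomp_iff _ _ _ _ _).1 hD
    have hy0 : 0 < q * x' := mul_pos hq0 hx'0
    have hyqq : q * x' < q * q₀ := by
      have : x' < q₀ := lt_of_le_of_lt hx'x (by nlinarith)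
      nlinarith
    have hta : q * x' * (M₀ : ℝ) ≤ q * q₀ * T := by
      have h1 : x' * (M₀ : ℝ) ≤ q₀ * (x₀ * (M₀ : ℝ)) := by
        have : x' * (M₀ : ℝ) ≤ (q₀ * x₀) * (M₀ : ℝ) := mul_le_mul_of_nonneg_right hx'x (Nat.cast_nonneg _)
        linarith [mul_assoc q₀ x₀ (M₀ : ℝ)]
      have h2 : q₀ * (x₀ * (M₀ : ℝ)) ≤ q₀ * T := mul_le_mul_of_nonneg_left t1 hq₀0.le
      nlinarith [mul_le_mul_of_nonneg_left (h1.trans h2) hq0.le]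
    have eμ : μ₀ = fun h => ∑ k, v k * ω k h := funext hμ
    refine ad3Decomp_mixture _ q _ _ _ v (fun k => gate (ω k) q₀) hv0 hv1 (fun h => by rw [eμ]; exact gate_sum_mixture v ω q₀ hv1 h)
      fun k hk => hG (q * x') q q₀ T M₀ (ω k) hy0 hq0 hq1 hq₀0 hq₀1 hyqq hta (hc k hk)
  | @mono x₀ x'' M₀ μ₀ h hx''0 hxx ih =>
    intro x' hx'0 hx'x q hq0 hq1
    exact ih x' hx'0 (hx'x.trans hxx) q hq0 hq1

/-- **`AD3GateCell ∧ AD3ConvClosedTB ⟹ TreeBuiltAD3`.** [this work] -/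
theorem treeBuiltAD3_of_gateCell_convClosedTB (hG : AD3GateCell) (hC : AD3ConvClosedTB) : TreeBuiltAD3 := by
  intro x M μ h q hq0 hq1
  obtain ⟨hx0, hx1, -⟩ := treeBuilt_lawFacts h
  exact ad3Decomp_of_treeBuilt_conv hG hC h x hx0 le_rfl q hq0 hq1

/-! ### The converse and the equivalence -/

/-- **`TreeBuiltAD3 ⟹ AD3ConvClosedTB`**: the convolution of two tree-built laws at a common floor is tree-built (`TreeBuilt.conv`), and its mean is
`T₁ + T₂` (`sum_mul_lconv`). [this work] -/
theorem ad3ConvClosedTB_of_treeBuiltAD3 (hA : TreeBuiltAD3) : AD3ConvClosedTB := by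
  intro x M₁ M₂ μ₁ μ₂ h₁ h₂ _ _ q hq0 hq1
  obtain ⟨-, -, -, -, s1, -⟩ := treeBuilt_lawFacts h₁
  obtain ⟨-, -, -, -, s2, -⟩ := treeBuilt_lawFacts h₂
  rw [← sum_mul_lconv M₁ M₂ μ₁ μ₂ s1 s2]
  exact hA x (M₁ + M₂) (lconv M₁ M₂ μ₁ μ₂) (TreeBuilt.conv h₁ h₂) q hq0 hq1

/-- **Modulo the gate cell, `TreeBuiltAD3` IS the convolution closure**: `AD3GateCell → (TreeBuiltAD3 ↔ AD3ConvClosedTB)`. [this work] -/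
theorem treeBuiltAD3_iff_convClosedTB (hG : AD3GateCell) : TreeBuiltAD3 ↔ AD3ConvClosedTB :=
  ⟨ad3ConvClosedTB_of_treeBuiltAD3, treeBuiltAD3_of_gateCell_convClosedTB hG⟩

/-- **`AD3GateCell ∧ AD3ConvClosedTB ⟹ SDECConvClosedTB`** (Route 2's node implies Route 1's node on trees, through `TreeBuiltAD3`). [this work] -/
theorem sdecConvClosedTB_of_ad3ConvClosedTB (hG : AD3GateCell) (hC : AD3ConvClosedTB) : SDECConvClosedTB :=
  sdecConvClosedTB_of_treeBuiltAD3 (treeBuiltAD3_of_gateCell_convClosedTB hG hC)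

end LawDec

/-! ### Down to the R8 tree row -/

/-- **`AD3GateCell ∧ AD3ConvClosedTB ⟹ Quant.FarTreeRow`** — Route 2 end to end after the refutation of the component product cell: the R8 tree
row from the (true, arm-2 g37) gate cell and ONE law-level node, the AD3⁺ convolution closure on tree-built factors.  CONDITIONAL on both (the
node is OPEN). [this work] -/
theorem farTreeRow_of_gateCell_convClosedTB (hG : LawDec.AD3GateCell) (hC : LawDec.AD3ConvClosedTB) : FarTreeRow :=
  farTreeRow_of_treeBuiltAD3 (LawDec.treeBuiltAD3_of_gateCell_convClosedTB hG hC)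

end Quant

end Summit.CriticalPhenomena.PercolationContinuityZ3.Theorems
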